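/-
Origin: expansion seat `prover-pub-hodgecm-mc-carch-1-0`, handover #CA7 2026-08-19T23:40Z md5 b955d8d89102 (125 l.; + cmBlockSection_snd_eq_one; NEW additive leaf; imports Model.HypCensus.ArchDatumBlockCM only — RUN-36 INSTALLED; RUN-38 row) (`HOME/mc/pub-hodgecm-mc-carch-1/pkg/HodgeCM/Model/ArchKTypeOfBlockSection.lean`, md5 b955d8d89102, 125 lines);
landed by the second packager (p2) in gate run 38 as `HodgeCM/Model/ArchKTypeOfBlockSection.lean` (verbatim).
-/
/-
Copyright (c) 2026. Released under Apache 2.0 license as described in the file LICENSE.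
Cell pub-hodgecm, MODEL layer (construction prover mc-carch-1, gen 0), BINDER-OWNERS row 12 `C`, junction (J-x₀)⇄(J-arch): the PLACE
COMPONENTS of binder-2's block section `HypCensus/ArchDatumBlockCM.cmBlockSection` — the right-hand side of the frame matching `hωA`
of `Model/ArchKTypeOfFrame` (companion of `Model/ArchKTypeOfSection`, which reads the left-hand side).
-/
import Summits.HodgeConjecture.HodgeCM.Model.HypCensus.ArchDatumBlockCM

/-!
# The components of `cmBlockSection eP eQ g` at the complex places of `L`

`cmBlockSection eP eQ = archPairSection … v₁ ∘ (Ginf.relabel … eP eQ 1 1)⁻¹` (binder-2), `archPairSection v₁ g = archPairSingle w(v₁)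
((archPairFrameEquiv v₁)⁻¹ g)` (tree T4 `ArchFollandDualPairPlaceSectionFrame`), `archPairSingle = archSingle × archSingle`.  Hence
(`v₁ = cmPlace L ι₁`, `w₁ = cmPlaceOver L v₁`):

* `cmBlockSection_fst` / `cmBlockSection_snd` — the two factors are `archSingle w₁` of the inverse-framed, un-relabelled components;
* `archAt_cmBlockSection_fst_self` / `_of_ne` — the `V`-factor has `w₁`-component `((archPairFrameEquiv v₁)⁻¹ (relabel⁻¹ g)).1` and
  trivial components elsewhere (the `W`-factor on `(u′, 1)` and the explicit matrix `D⁻¹ · reindex ε⁻¹ (…) · D` of the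
  `w₁`-component via `coe_toUForm_GL` are the next two lemmas of this file — TODO, carch-1).

Nothing is cited and nothing is minted: kernel lemmas unfolding installed definitions.
-/

set_option autoImplicit false

noncomputable section

open NumberField NumberField.InfinitePlace IsDedekindDomain
open scoped Matrix Classical
open Literature.NumberTheory.Automorphic Literature.NumberTheory.Automorphic.UnitaryGroup Literature.NumberTheory.Weil1964
open Literature.RepresentationTheory.KonnoKonno2007 Literature.RepresentationTheory.KonnoKonno2007.RealDualPair
open Literature.NumberTheory.GelbartRogawski1991 Literature.NumberTheory.GelbartRogawski1991.UnitaryDualPair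

namespace HodgeCM.Model.HypCensus

section BlockSectionComponents

variable (L : Type) [Field L] [NumberField L] [IsCMField L] {N M n : ℕ} (e : Fin N × Fin M ≃ Fin n)
variable (dV : Fin N → L) (hdV : ∀ i, IsCMField.complexConj L (dV i) = dV i) (hdV0 : ∀ i, dV i ≠ 0)
variable (dW : Fin M → L) (hdW : ∀ i, IsCMField.complexConj L (dW i) = dW i) (hdW0 : ∀ i, dW i ≠ 0)
variable (ι₁ : L →+* ℂ)
variable (eP : PosIdx (cmXV L dV hdV ι₁ (cmPlace L ι₁)) ≃ Fin 2) (eQ : NegIdx (cmXV L dV hdV ι₁ (cmPlace L ι₁)) ≃ Unit)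

/-- the pair frame isomorphism of the pin at `v₁ = cmPlace ι₁` (T4's `archPairFrameEquiv` with binder-2's canonical arguments). -/
abbrev cmPairFrameEquiv :=
  archPairFrameEquiv L (IsCMField.complexConj L) N M (IsCMField.complexConj_ne_one L) (cmPlaceOver L) (cmPlaceOver_smul L)
    (cmPlaceOver_comap L) (cmRealVec L dV hdV) (cmRealVec L dW hdW) (realDiagonal_map L dV hdV).symm
    (realDiagonal_map L dW hdW).symm (cmEpsV L dV hdV ι₁) (cmEpsW L dV dW hdW ι₁) (cmDV_ne_zero L dV hdV hdV0 ι₁)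
    (cmDW_ne_zero L dV dW hdW hdW0 ι₁) (cmSignConv_ne_zero L dV ι₁) (cmCW_ne_zero L dV ι₁) (cm_htV L dV hdV hdV0 ι₁)
    (cm_htW L dV dW hdW hdW0 ι₁) (cmPlace L ι₁)

/-- the relabelling of the pin (binder-2's, `V`-side `eP`/`eQ`, `W`-side identity). -/
abbrev cmRelabel :=
  Ginf.relabel (PosIdx (cmXV L dV hdV ι₁ (cmPlace L ι₁))) (NegIdx (cmXV L dV hdV ι₁ (cmPlace L ι₁)))
    (PosIdx (cmXW L dV dW hdW ι₁ (cmPlace L ι₁))) (NegIdx (cmXW L dV dW hdW ι₁ (cmPlace L ι₁))) (Fin 2) Unit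
    (PosIdx (cmXW L dV dW hdW ι₁ (cmPlace L ι₁))) (NegIdx (cmXW L dV dW hdW ι₁ (cmPlace L ι₁))) eP eQ (Equiv.refl _)
    (Equiv.refl _)

/-- **The `V`-factor of the block section** is `archSingle w₁` of the first inverse-framed, un-relabelled component. -/
theorem cmBlockSection_fst
    (g : Ginf (Fin 2) Unit (PosIdx (cmXW L dV dW hdW ι₁ (cmPlace L ι₁))) (NegIdx (cmXW L dV dW hdW ι₁ (cmPlace L ι₁)))) :
    (cmBlockSection L dV hdV hdV0 dW hdW hdW0 ι₁ eP eQ g).1 =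
      archSingle (↥(maximalRealSubfield L)) L (IsCMField.complexConj L) N (Matrix.diagonal dV) (IsCMField.complexConj_ne_one L)
        (complexConj_smul_infinitePlace L) (cmPlaceOver L (cmPlace L ι₁))
        ((cmPairFrameEquiv L dV hdV hdV0 dW hdW hdW0 ι₁).symm ((cmRelabel L dV hdV dW hdW ι₁ eP eQ).symm g)).1 :=
  rfl

/-- **The `W`-factor of the block section** is `archSingle w₁` of the second inverse-framed, un-relabelled component. -/
theorem cmBlockSection_snd
    (g : Ginf (Fin 2) Unit (PosIdx (cmXW L dV dW hdW ι₁ (cmPlace L ι₁))) (NegIdx (cmXW L dV dW hdW ι₁ (cmPlace L ι₁)))) :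
    (cmBlockSection L dV hdV hdV0 dW hdW hdW0 ι₁ eP eQ g).2 =
      archSingle (↥(maximalRealSubfield L)) L (IsCMField.complexConj L) M (Matrix.diagonal dW) (IsCMField.complexConj_ne_one L)
        (complexConj_smul_infinitePlace L) (cmPlaceOver L (cmPlace L ι₁))
        ((cmPairFrameEquiv L dV hdV hdV0 dW hdW hdW0 ι₁).symm ((cmRelabel L dV hdV dW hdW ι₁ eP eQ).symm g)).2 :=
  rfl

/-- **At `w₁ = cmPlaceOver (cmPlace ι₁)` the `V`-factor's component is the inverse-framed, un-relabelled `V`-block.** -/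
theorem archAt_cmBlockSection_fst_self
    (g : Ginf (Fin 2) Unit (PosIdx (cmXW L dV dW hdW ι₁ (cmPlace L ι₁))) (NegIdx (cmXW L dV dW hdW ι₁ (cmPlace L ι₁)))) :
    archAt (↥(maximalRealSubfield L)) L (IsCMField.complexConj L) N (Matrix.diagonal dV) (cmPlaceOver L (cmPlace L ι₁))
        (complexConj_smul_infinitePlace L _) (IsCMField.complexConj_ne_one L)
        (cmBlockSection L dV hdV hdV0 dW hdW hdW0 ι₁ eP eQ g).1 =
      ((cmPairFrameEquiv L dV hdV hdV0 dW hdW hdW0 ι₁).symm ((cmRelabel L dV hdV dW hdW ι₁ eP eQ).symm g)).1 := by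
  rw [cmBlockSection_fst, archAt_archSingle_self]

/-- **Away from `w₁` the `V`-factor's component is trivial.** -/
theorem archAt_cmBlockSection_fst_of_ne {w : {w : InfinitePlace L // w.IsComplex}} (h : w ≠ cmPlaceOver L (cmPlace L ι₁))
    (g : Ginf (Fin 2) Unit (PosIdx (cmXW L dV dW hdW ι₁ (cmPlace L ι₁))) (NegIdx (cmXW L dV dW hdW ι₁ (cmPlace L ι₁)))) :
    archAt (↥(maximalRealSubfield L)) L (IsCMField.complexConj L) N (Matrix.diagonal dV) w
        (complexConj_smul_infinitePlace L _) (IsCMField.complexConj_ne_one L)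
        (cmBlockSection L dV hdV hdV0 dW hdW hdW0 ι₁ eP eQ g).1 = 1 := by
  rw [cmBlockSection_fst, archAt_archSingle_of_ne _ _ _ _ _ _ _ _ h]

/-- the un-relabelling is factor by factor: second component. -/
theorem cmRelabel_symm_apply_snd
    (g : Ginf (Fin 2) Unit (PosIdx (cmXW L dV dW hdW ι₁ (cmPlace L ι₁))) (NegIdx (cmXW L dV dW hdW ι₁ (cmPlace L ι₁)))) :
    ((cmRelabel L dV hdV dW hdW ι₁ eP eQ).symm g).2 =
      (UForm.relabel (PosIdx (cmXW L dV dW hdW ι₁ (cmPlace L ι₁))) (NegIdx (cmXW L dV dW hdW ι₁ (cmPlace L ι₁)))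
        (PosIdx (cmXW L dV dW hdW ι₁ (cmPlace L ι₁))) (NegIdx (cmXW L dV dW hdW ι₁ (cmPlace L ι₁)))
        (Equiv.refl _) (Equiv.refl _)).symm g.2 :=
  rfl

/-- the inverse pair frame is factor by factor: second component. -/
theorem cmPairFrameEquiv_symm_apply_snd
    (x : UForm (PosIdx (cmXV L dV hdV ι₁ (cmPlace L ι₁))) (NegIdx (cmXV L dV hdV ι₁ (cmPlace L ι₁))) ×
      UForm (PosIdx (cmXW L dV dW hdW ι₁ (cmPlace L ι₁))) (NegIdx (cmXW L dV dW hdW ι₁ (cmPlace L ι₁)))) :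
    ((cmPairFrameEquiv L dV hdV hdV0 dW hdW hdW0 ι₁).symm x).2 =
      ((cmPairFrameEquiv L dV hdV hdV0 dW hdW hdW0 ι₁).symm (1, x.2)).2 :=
  rfl

/-- **On `(u′, 1)` the `W`-factor of the block section is trivial.** -/
theorem cmBlockSection_snd_eq_one (u : UForm (Fin 2) Unit) :
    (cmBlockSection L dV hdV hdV0 dW hdW hdW0 ι₁ eP eQ
        ((u, (1 : UForm (PosIdx (cmXW L dV dW hdW ι₁ (cmPlace L ι₁))) (NegIdx (cmXW L dV dW hdW ι₁ (cmPlace L ι₁))))) :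
          Ginf (Fin 2) Unit _ _)).2 = 1 := by
  rw [cmBlockSection_snd, cmPairFrameEquiv_symm_apply_snd, cmRelabel_symm_apply_snd, map_one]
  rw [show ((1 : UForm (PosIdx (cmXV L dV hdV ι₁ (cmPlace L ι₁))) (NegIdx (cmXV L dV hdV ι₁ (cmPlace L ι₁)))),
      (1 : UForm (PosIdx (cmXW L dV dW hdW ι₁ (cmPlace L ι₁))) (NegIdx (cmXW L dV dW hdW ι₁ (cmPlace L ι₁))))) =
      (1 : Ginf _ _ _ _) from rfl, map_one, Prod.snd_one, map_one]

end BlockSectionComponents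

end HodgeCM.Model.HypCensus

end
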